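import Mathlib
import Summits.QuantumFields.BalabanUV.Beta.CoarseCoerciveCovariantGauge
import Summits.QuantumFields.BalabanUV.Beta.AccretiveCombesThomas
import Summits.QuantumFields.BalabanUV.Beta.CoarseCoerciveBlock1D
import Summits.QuantumFields.BalabanUV.Beta.CoarseCoerciveTransportPair

/-!
# [Balaban1985BackgroundPropagators] (3.16) p. 393 ∕ (3.35) p. 396 — THE COVARIANT LAPLACIAN AS THE GRAM FORM OF THE
# COVARIANT BOND DIFFERENCES, and NOTE-I3 §5.2 (s) in kernel form: `covLap μ W = μ·1 + D_Wᴴ D_W` is Hermitian, a unit,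
# `Re`-coercive and Gram-dominated by itself, so the four fine-form hypotheses of `coarse_coercive_cov` are DISCHARGED for
# it; bounded Hermitian perturbations `P` (`|Re z*Pz| ≤ p‖z‖²`, `p < μ` — the a-terms and Δ″ of the multiscale fine form)
# only shift the mass constant `μ ↦ μ + p`: `(δ²∕((μ + p)S₁S₂ + θ₁′θ₂′))‖B‖² ≤ Re B*(Q (covLap + P)⁻¹ Q*)B` for EVERY
# transport field (cell topic `Summits/QuantumFields/BalabanUV/Beta`; row-D4 interface item (I3), E-I3 leaf (s))

HONEST FRAMING (cell rule).  Discharging `BetaPertH` makes Bałaban's UV stability UNCONDITIONAL — a real constructive-QFT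
result; NOT the continuum limit, NOT the Clay problem.  This module discharges NOTHING of `BetaPertH`.  [folklore] linear
algebra, kernel-checked.  WHY: `CoarseCoerciveCovariantEnergy.coarse_coercive_cov` (p221805) and
`CoarseCoerciveCovariantGauge.coarse_coercive_cov_uniform` (p222288) take an ABSTRACT fine form `A` with four hypotheses
(Hermitian, unit, `Re`-psd, Gram domination `Re z*Az ≤ μ‖z‖² + ‖D_W z‖²`).  For the canonical fine form — the massive
covariant Laplacian `μ·1 + D_Wᴴ D_W` of the SAME transporters `W` — all four hold by a one-line form computation
(`z*(μ + DᴴD)z = μ‖z‖² + ‖Dz‖²`), and a co-owner's MODEL instance (beta-d4-p2's announced (C) `CovariantPlateauBlocks`,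
journal l.15376) then supplies ONLY the graph (`src`, `tgt`), the transporters `W`, the contour transports `R`, the
holonomy-defect bound and the counting.  NOTE-I3 v1.1 §5.2 (s) («the a-terms Σ_j a(L^jη)^{d−2}|Q_j r_B|² are MASS-type …
Δ″ is a bounded LOCAL operator with the small factor α₀ … its contribution to E is O(Mα₀)×(mass)») is the statement that the
multiscale fine form of B9 (3.16) + (3.138) differs from the top-scale covariant Laplacian by a bounded Hermitian
perturbation; §2–§3 here make «bounded Hermitian perturbations only shift μ» a kernel statement (`coarse_coercive_covLap_add`),
the SIZE `p` of the perturbation (a·Σ_j(L^jη)^{d−2}‖Q_j‖² and O(α₀)) being O.2-level counting, NOT done here.  Nothing of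
Bałaban's operators is instantiated; NO class change on any GAPS row (G-B9-15 decomposed, not closed); readiness width 0
unchanged; D4 DISCHARGE NO DATE; NOT summit progress.  Unit `b2b-balaban-beta-an4-g40` (owner lineage of
`BINDER-OWNERS.md` row D4); `GAPS.md` C-an4-117.

VERSIONS.  v1 = p222702 (§1–§4).  **v1.1 (gen 40, same seat; APPEND-ONLY — every v1 declaration byte-identical; two imports
added) adds §5–§7** after the co-owner's finding F-d4p3-16 ∕ the owner's ERRATUM E-I3-1 (NOTE-I3 v1.2 §6, GAPS E-an4-118,
RULING R-an4-40-1 journal l.15847): B9 (3.19)'s contours are the RECURSIVE chains of (3.55), so the j-UNIFORM instance for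
print's composed averages `Q′_j` is the TWO-TRANSPORT one (bump on straight ∕ one-step-tree transports `R̃`, average on the
recursive `R`; co-owner beta-d4-p3's `CoarseCoerciveTransportPair.coarse_coercive_cov₂`, p222847) — §5 records that `covLap`
IS g39's `CoarseCoerciveBlock1D.gramForm` of `covDiff` (`rfl`; §1 re-derived that API — an avoidable duplication, kept for
append-only hygiene), §6 gives the energy side with a gradient WEIGHT `κ` (`Re z*Az ≤ μ‖z‖² + κ‖D_Wz‖²`) and the two-transport
assembly `coarse_coercive_cov₂_kappa`, §7 the two-transport `covLap` ENDs: pure (`coarse_coercive_covLap₂`), PSD perturbation of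
ANY size (`…_add_psd`: the a-terms of (3.16)), RELATIVE perturbation `|Re z*Pz| ≤ ρ·Re z*(covLap)z`, `ρ < 1` (`…_add_rel`: Δ″
small relative to the Laplacian — d4-p3's XREAD INFO-2, C-d4p3-17).  v1 §3's `(1 + O(1)Mα₀)²` readings are superseded (E-I3-1).

CITATION HEADER (lean-in-tree rule).  [13] = T. Bałaban, *Propagators for lattice gauge theories in a background field*,
Commun. Math. Phys. **99**, 389–434 (1985) [Balaban1985BackgroundPropagators]; p. 393 [PDF 5] (3.16) verbatim (NOTE-I3
v1.1 §5.2, render `HOME/b2b-balaban-ref1/pages/1985-cmp99-background-propagators/…-p005-x2.png` READ AS IMAGE 2026-08-20 by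
gen 39 of this lineage): *"⟨A, Q*aQA⟩ = Σ_{j=0}^k a Σ_{b∈Λ_j}(L^jη)^{d−2}|(Q_j(U)A)(b)|²"*; p. 396 (3.35) as quoted in
`CoarseCoerciveCovariantEnergy`.  LOCATOR only; nothing printed is asserted.

WHAT IS CERTIFIED HERE (kernel, sorry-free; [folklore]).
§1 `covLap μ src tgt W := μ·1 + (covDiff src tgt W)ᴴ·covDiff src tgt W`; `covLap_isHermitian`; **`form_covLap`**∕
   `re_form_covLap` (`z*(covLap)z = μ‖z‖² + ‖D_W z‖²`); `covLap_reCoercive`; `covLap_re_nonneg`; `covLap_isUnit` (μ > 0, via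
   d4-p3's `AccretiveCombesThomas.isUnit_of_reCoercive`).
§2 `covLap_add_isHermitian`, **`covLap_add_reCoercive`** (`μ − p`), **`covLap_add_gramDominated`** (`μ + p`) for a Hermitian
   `P` with `|Re z*Pz| ≤ p‖z‖²`.
§3 **`coarse_coercive_covLap_add`** (`p < μ`: `(δ²∕((μ + p)S₁S₂ + θ₁′θ₂′))‖B‖² ≤ Re B*(sandwich (covLap + P) (covFamily s R))B`),
   **`coarse_coercive_covLap`** (pure: `δ²∕(μS₁S₂ + θ₁′θ₂′)`), **`coarse_coercive_covLap_uniform`** (`h ≤ H`, out-degree `≤ d`: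
   `δ²∕(μS₁S₂ + (θ₁ + H·S₁)(θ₂ + H·d·S₂))`) — the fine-form hypotheses GONE; what remains is geometry + transports +
   holonomy bound + counting.
§4 Non-vacuity (one site, one flat self-bond, trivial fibre).
NOT CLAIMED.  The size `p` of Bałaban's a-terms∕Δ″; any lattice instance; k-uniformity.  NOT summit progress.
PRIOR ART IN THE TREE (searched 2026-08-20: `lean search 'covLap|lapA|gramForm|covariant.*Gram'`): beta-d4-p2's
`TentQuasiReconstructionLaplacian.lapA` (U = 1 MODEL: `μ·1 + Σ_i D_iᴴD_i` on `(ℤ∕m × Fin n)^ν`, same form computation —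
the instance at `W ≡ 1`); gen 39's `CoarseCoerciveBlock1D.gramForm` (`μ + D*D`, ν = 1, scalar); T4 NE2's
`ColourCovariantLaplacian.covLapC` (a TERM for the rough covariant Laplacian in the T⁴ cell's currency, no coarse operator).
No fibred `μ + D_WᴴD_W` with the `coarse_coercive_cov` socket in the tree.
-/

namespace Summit.QuantumFields.BalabanUV.Beta.CoarseCoerciveCovariantLaplacian

open scoped BigOperators Matrix ComplexConjugate
open Finset Matrix
open Summit.QuantumFields.BalabanUV.Beta.AccretiveCombesThomasSandwich (sandwich)
open Summit.QuantumFields.BalabanUV.Beta.UnitLatticeResolventWalk (Qm superpose)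
open Summit.QuantumFields.BalabanUV.Beta.CoarseCoerciveTransport (covFamily)
open Summit.QuantumFields.BalabanUV.Beta.CoarseCoerciveCovariantEnergy (l2 cpx covDiff hol coarse_coercive_cov)
open Summit.QuantumFields.BalabanUV.Beta.CoarseCoerciveCovariantGauge (coarse_coercive_cov_uniform l2_zero)
open Summit.QuantumFields.BalabanUV.Beta.AccretiveCombesThomas (isUnit_of_reCoercive)
open Literature.MathematicalPhysics.QuantumFieldTheory.Balaban1983to89.B5Prop11Lower (nsq nsq_nonneg
  star_dotProduct_self)

noncomputable section

variable {S Cp μ ι : Type*} [Fintype S] [Fintype Cp] [Fintype μ] [Fintype ι] [DecidableEq S] [DecidableEq Cp]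

/-! ## §1 The covariant Laplacian as the Gram form of the covariant bond differences -/

/-- **THE COVARIANT LAPLACIAN WITH MASS**: `covLap μ src tgt W = μ·1 + D_Wᴴ·D_W` on the fibred lattice `S × Cp` — the Gram
form of the covariant bond-difference operator `covDiff src tgt W` (with the parallel transporters of a lattice gauge field
this is the background-field covariant Laplacian; `W ≡ 1` is the free one). [folklore] -/
def covLap (μ0 : ℝ) (src tgt : ι → S) (W : ι → Matrix Cp Cp ℝ) : Matrix (S × Cp) (S × Cp) ℂ :=
  ((μ0 : ℝ) : ℂ) • (1 : Matrix (S × Cp) (S × Cp) ℂ) + (covDiff src tgt W)ᴴ * covDiff src tgt W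

omit [Fintype S] in
/-- `covLap` is Hermitian. [folklore] -/
theorem covLap_isHermitian (μ0 : ℝ) (src tgt : ι → S) (W : ι → Matrix Cp Cp ℝ) :
    (covLap μ0 src tgt W).IsHermitian := by
  unfold Matrix.IsHermitian covLap
  rw [Matrix.conjTranspose_add, Matrix.conjTranspose_smul, Matrix.conjTranspose_one, Matrix.conjTranspose_mul,
    Matrix.conjTranspose_conjTranspose, Complex.star_def, Complex.conj_ofReal]

/-- **THE FORM**: `z*(covLap)z = μ‖z‖² + ‖D_W z‖²`. [folklore] -/
theorem form_covLap (μ0 : ℝ) (src tgt : ι → S) (W : ι → Matrix Cp Cp ℝ) (z : S × Cp → ℂ) :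
    star z ⬝ᵥ (covLap μ0 src tgt W *ᵥ z) = ((μ0 * nsq z + nsq (covDiff src tgt W *ᵥ z) : ℝ) : ℂ) := by
  rw [covLap, Matrix.add_mulVec, Matrix.smul_mulVec, Matrix.one_mulVec, dotProduct_add, dotProduct_smul,
    ← Matrix.mulVec_mulVec, Matrix.dotProduct_mulVec, Matrix.vecMul_conjTranspose, star_star, star_dotProduct_self,
    star_dotProduct_self, smul_eq_mul]
  push_cast
  ring

/-- The real part of the form: `Re z*(covLap)z = μ‖z‖² + ‖D_W z‖²` — so `covLap` is Gram-dominated by ITSELF (the `hA` of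
`CoarseCoerciveCovariantEnergy.coarse_coercive_cov` with equality). [folklore] -/
theorem re_form_covLap (μ0 : ℝ) (src tgt : ι → S) (W : ι → Matrix Cp Cp ℝ) (z : S × Cp → ℂ) :
    (star z ⬝ᵥ (covLap μ0 src tgt W *ᵥ z)).re = μ0 * nsq z + nsq (covDiff src tgt W *ᵥ z) := by
  rw [form_covLap, Complex.ofReal_re]

/-- `covLap` is `Re`-coercive with constant `μ`. [folklore] -/
theorem covLap_reCoercive (μ0 : ℝ) (src tgt : ι → S) (W : ι → Matrix Cp Cp ℝ) (z : S × Cp → ℂ) :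
    μ0 * nsq z ≤ (star z ⬝ᵥ (covLap μ0 src tgt W *ᵥ z)).re := by
  rw [re_form_covLap]
  exact le_add_of_nonneg_right (nsq_nonneg _)

/-- `covLap` is `Re`-positive semidefinite for `μ ≥ 0`. [folklore] -/
theorem covLap_re_nonneg {μ0 : ℝ} (hμ : 0 ≤ μ0) (src tgt : ι → S) (W : ι → Matrix Cp Cp ℝ) (z : S × Cp → ℂ) :
    0 ≤ (star z ⬝ᵥ (covLap μ0 src tgt W *ᵥ z)).re :=
  (mul_nonneg hμ (nsq_nonneg z)).trans (covLap_reCoercive μ0 src tgt W z)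

/-- `covLap` is a unit for `μ > 0` (d4-p3's `AccretiveCombesThomas.isUnit_of_reCoercive` by name). [folklore] -/
theorem covLap_isUnit {μ0 : ℝ} (hμ : 0 < μ0) (src tgt : ι → S) (W : ι → Matrix Cp Cp ℝ) :
    IsUnit (covLap μ0 src tgt W) :=
  isUnit_of_reCoercive hμ (covLap_reCoercive μ0 src tgt W)

/-! ## §2 Bounded Hermitian perturbations are absorbed in the mass constant (NOTE-I3 §5.2 (s): the a-terms and Δ″) -/

omit [Fintype S] in
/-- The perturbed fine form `covLap μ W + P`, `P` Hermitian with `|Re z*Pz| ≤ p‖z‖²`: Hermitian. [folklore] -/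
theorem covLap_add_isHermitian (μ0 : ℝ) (src tgt : ι → S) (W : ι → Matrix Cp Cp ℝ)
    {P : Matrix (S × Cp) (S × Cp) ℂ} (hP : P.IsHermitian) : (covLap μ0 src tgt W + P).IsHermitian :=
  (covLap_isHermitian μ0 src tgt W).add hP

/-- … `Re`-coercive with constant `μ − p`. [folklore] -/
theorem covLap_add_reCoercive (μ0 : ℝ) (src tgt : ι → S) (W : ι → Matrix Cp Cp ℝ) {P : Matrix (S × Cp) (S × Cp) ℂ}
    {p : ℝ} (hPb : ∀ z : S × Cp → ℂ, |(star z ⬝ᵥ (P *ᵥ z)).re| ≤ p * nsq z) (z : S × Cp → ℂ) :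
    (μ0 - p) * nsq z ≤ (star z ⬝ᵥ ((covLap μ0 src tgt W + P) *ᵥ z)).re := by
  rw [Matrix.add_mulVec, dotProduct_add, Complex.add_re]
  have h1 := covLap_reCoercive μ0 src tgt W z
  have h2 := (abs_le.1 (hPb z)).1
  linarith

/-- … Gram-dominated with mass constant `μ + p`: `Re z*(covLap + P)z ≤ (μ + p)‖z‖² + ‖D_W z‖²`. [folklore] -/
theorem covLap_add_gramDominated (μ0 : ℝ) (src tgt : ι → S) (W : ι → Matrix Cp Cp ℝ)
    {P : Matrix (S × Cp) (S × Cp) ℂ} {p : ℝ} (hPb : ∀ z : S × Cp → ℂ, |(star z ⬝ᵥ (P *ᵥ z)).re| ≤ p * nsq z)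
    (z : S × Cp → ℂ) :
    (star z ⬝ᵥ ((covLap μ0 src tgt W + P) *ᵥ z)).re ≤ (μ0 + p) * nsq z + nsq (covDiff src tgt W *ᵥ z) := by
  rw [Matrix.add_mulVec, dotProduct_add, Complex.add_re, re_form_covLap]
  have h2 := (abs_le.1 (hPb z)).2
  linarith

/-! ## §3 Coarse coercivity for the (perturbed) covariant Laplacian: the fine-form hypotheses DISCHARGED -/

omit [DecidableEq S] in
/-- **COARSE COERCIVITY OF `Q A⁻¹ Q*` FOR THE PERTURBED COVARIANT LAPLACIAN** `A = covLap μ W + P` (`P` Hermitian,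
`|Re z*Pz| ≤ p‖z‖²`, `p < μ`): with the covariant average `q = covFamily s R`, the in-block covariant quasi-reconstruction
`r = covFamily t R`, `R·Rᵀ = 1`, `WᵀW = 1`, block mass number `δ`, holonomy-defect bounds `h` and counting data —
`(δ²∕((μ + p)S₁S₂ + θ₁′θ₂′))·‖B‖² ≤ Re B*(sandwich A q)B`.  The four fine-form hypotheses of `coarse_coercive_cov`
(Hermitian, unit, `Re`-psd, Gram domination) are DISCHARGED; `P = 0`, `p = 0` is the pure covariant Laplacian.
NOTE-I3 §5.2 (s) in kernel form: the a-terms (positive) and Δ″ (small, local) of the multiscale fine form only shift `μ`.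
[cite: Balaban1985BackgroundPropagators, (3.16) p.393, (3.35) p.396] -/
theorem coarse_coercive_covLap_add [DecidableEq S] [DecidableEq μ] (μ0 : ℝ) (src tgt : ι → S)
    (W : ι → Matrix Cp Cp ℝ) {P : Matrix (S × Cp) (S × Cp) ℂ} (hP : P.IsHermitian) {p : ℝ} (hp0 : 0 ≤ p) (hpμ : p < μ0)
    (hPb : ∀ z : S × Cp → ℂ, |(star z ⬝ᵥ (P *ᵥ z)).re| ≤ p * nsq z)
    (t s : μ → S → ℝ) (hdisj : ∀ y y' x, y ≠ y' → t y x * s y' x = 0) (R : μ → S → Matrix Cp Cp ℝ)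
    (hR : ∀ y x, R y x * (R y x)ᵀ = 1) (hW : ∀ b, (W b)ᵀ * W b = 1) {δ : ℝ} (hδ0 : 0 < δ)
    (hδ : ∀ y, δ ≤ ∑ x, t y x * s y x) (h : ι → μ → ℝ) (hh : ∀ b y, 0 ≤ h b y)
    (hhol : ∀ b y v, l2 (cpx (hol src tgt W R b y - 1) *ᵥ v) ≤ h b y * l2 v) {S₁ S₂ θ₁ θ₂ : ℝ} (hS0 : 0 ≤ S₁)
    (hS₁ : ∀ x, ∑ y, |t y x| ≤ S₁) (hS₂ : ∀ y, ∑ x, |t y x| ≤ S₂) (hθ0 : 0 ≤ θ₁)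
    (hθ₁ : ∀ b, ∑ y, (|t y (tgt b) - t y (src b)| + |t y (src b)| * h b y) ≤ θ₁)
    (hθ₂ : ∀ y, ∑ b, (|t y (tgt b) - t y (src b)| + |t y (src b)| * h b y) ≤ θ₂)
    (hE : 0 < (μ0 + p) * (S₁ * S₂) + θ₁ * θ₂) (B : μ × Cp → ℂ) :
    δ ^ 2 / ((μ0 + p) * (S₁ * S₂) + θ₁ * θ₂) * nsq B ≤
      (star B ⬝ᵥ (sandwich (covLap μ0 src tgt W + P) (covFamily s R) *ᵥ B)).re := by
  have hco := covLap_add_reCoercive μ0 src tgt W hPb (P := P)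
  exact coarse_coercive_cov (covLap μ0 src tgt W + P) (covLap_add_isHermitian μ0 src tgt W hP)
    (isUnit_of_reCoercive (sub_pos.2 hpμ) hco)
    (fun g => (mul_nonneg (sub_pos.2 hpμ).le (nsq_nonneg g)).trans (hco g)) src tgt W (by linarith)
    (covLap_add_gramDominated μ0 src tgt W hPb) t s hdisj R hR hW hδ0 hδ h hh hhol hS0 hS₁ hS₂ hθ0 hθ₁ hθ₂ hE B

omit [DecidableEq S] in
/-- **THE PURE COVARIANT LAPLACIAN**: `A = μ·1 + D_Wᴴ D_W`, `μ > 0` — `(δ²∕(μS₁S₂ + θ₁′θ₂′))·‖B‖² ≤ Re B*(Q A⁻¹ Q*)B`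
for every transport field, given only the geometric∕counting data and the holonomy-defect bound. [cite: Balaban1985BackgroundPropagators, (3.16) p.393, (3.35) p.396] -/
theorem coarse_coercive_covLap [DecidableEq S] [DecidableEq μ] {μ0 : ℝ} (hμ : 0 < μ0) (src tgt : ι → S)
    (W : ι → Matrix Cp Cp ℝ) (t s : μ → S → ℝ) (hdisj : ∀ y y' x, y ≠ y' → t y x * s y' x = 0)
    (R : μ → S → Matrix Cp Cp ℝ) (hR : ∀ y x, R y x * (R y x)ᵀ = 1) (hW : ∀ b, (W b)ᵀ * W b = 1) {δ : ℝ}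
    (hδ0 : 0 < δ) (hδ : ∀ y, δ ≤ ∑ x, t y x * s y x) (h : ι → μ → ℝ) (hh : ∀ b y, 0 ≤ h b y)
    (hhol : ∀ b y v, l2 (cpx (hol src tgt W R b y - 1) *ᵥ v) ≤ h b y * l2 v) {S₁ S₂ θ₁ θ₂ : ℝ} (hS0 : 0 ≤ S₁)
    (hS₁ : ∀ x, ∑ y, |t y x| ≤ S₁) (hS₂ : ∀ y, ∑ x, |t y x| ≤ S₂) (hθ0 : 0 ≤ θ₁)
    (hθ₁ : ∀ b, ∑ y, (|t y (tgt b) - t y (src b)| + |t y (src b)| * h b y) ≤ θ₁)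
    (hθ₂ : ∀ y, ∑ b, (|t y (tgt b) - t y (src b)| + |t y (src b)| * h b y) ≤ θ₂)
    (hE : 0 < μ0 * (S₁ * S₂) + θ₁ * θ₂) (B : μ × Cp → ℂ) :
    δ ^ 2 / (μ0 * (S₁ * S₂) + θ₁ * θ₂) * nsq B ≤
      (star B ⬝ᵥ (sandwich (covLap μ0 src tgt W) (covFamily s R) *ᵥ B)).re :=
  coarse_coercive_cov (covLap μ0 src tgt W) (covLap_isHermitian μ0 src tgt W) (covLap_isUnit hμ src tgt W)
    (covLap_re_nonneg hμ.le src tgt W) src tgt W hμ.le (fun z => (re_form_covLap μ0 src tgt W z).le) t s hdisj R hR hW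
    hδ0 hδ h hh hhol hS0 hS₁ hS₂ hθ0 hθ₁ hθ₂ hE B

omit [DecidableEq S] in
/-- **THE PURE COVARIANT LAPLACIAN, UNIFORM-HOLONOMY FORM**: `h ≤ H`, out-degree `≤ d` ⟹
`(δ²∕(μS₁S₂ + (θ₁ + H·S₁)(θ₂ + H·d·S₂)))·‖B‖² ≤ Re B*(Q A⁻¹ Q*)B` — U = 1 counting data + `(H, d)` + NOTHING ELSE.
[cite: Balaban1985BackgroundPropagators, (3.16) p.393, (3.35) p.396] -/
theorem coarse_coercive_covLap_uniform [DecidableEq S] [DecidableEq μ] {μ0 : ℝ} (hμ : 0 < μ0) (src tgt : ι → S)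
    (W : ι → Matrix Cp Cp ℝ) (t s : μ → S → ℝ) (hdisj : ∀ y y' x, y ≠ y' → t y x * s y' x = 0)
    (R : μ → S → Matrix Cp Cp ℝ) (hR : ∀ y x, R y x * (R y x)ᵀ = 1) (hW : ∀ b, (W b)ᵀ * W b = 1) {δ : ℝ}
    (hδ0 : 0 < δ) (hδ : ∀ y, δ ≤ ∑ x, t y x * s y x) (h : ι → μ → ℝ) (hh : ∀ b y, 0 ≤ h b y) {H : ℝ}
    (hH0 : 0 ≤ H) (hhH : ∀ b y, h b y ≤ H)
    (hhol : ∀ b y v, l2 (cpx (hol src tgt W R b y - 1) *ᵥ v) ≤ h b y * l2 v) {d : ℕ}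
    (hdeg : ∀ x, (Finset.univ.filter fun b => src b = x).card ≤ d) {S₁ S₂ θ₁ θ₂ : ℝ} (hS0 : 0 ≤ S₁)
    (hS₁ : ∀ x, ∑ y, |t y x| ≤ S₁) (hS₂ : ∀ y, ∑ x, |t y x| ≤ S₂) (hθ0 : 0 ≤ θ₁)
    (hθ₁ : ∀ b, ∑ y, |t y (tgt b) - t y (src b)| ≤ θ₁) (hθ₂ : ∀ y, ∑ b, |t y (tgt b) - t y (src b)| ≤ θ₂)
    (hE : 0 < μ0 * (S₁ * S₂) + (θ₁ + H * S₁) * (θ₂ + H * (d * S₂))) (B : μ × Cp → ℂ) :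
    δ ^ 2 / (μ0 * (S₁ * S₂) + (θ₁ + H * S₁) * (θ₂ + H * (d * S₂))) * nsq B ≤
      (star B ⬝ᵥ (sandwich (covLap μ0 src tgt W) (covFamily s R) *ᵥ B)).re :=
  coarse_coercive_cov_uniform (covLap μ0 src tgt W) (covLap_isHermitian μ0 src tgt W) (covLap_isUnit hμ src tgt W)
    (covLap_re_nonneg hμ.le src tgt W) src tgt W hμ.le (fun z => (re_form_covLap μ0 src tgt W z).le) t s hdisj R hR hW
    hδ0 hδ h hh hH0 hhH hhol hdeg hS0 hS₁ hS₂ hθ0 hθ₁ hθ₂ hE B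

/-! ## §4 Non-vacuity: the pure covariant Laplacian of one flat self-bond -/

/-- One site, one self-bond with `W = 1`, trivial fibre, `μ = 2`, `R = 1`, `t = s = 1`: `covLap 2 = 2·1 + 0` and
`coarse_coercive_covLap` gives `(1²∕(2·1 + 0·0))‖B‖² ≤ Re B*(sandwich (covLap 2 …) q)B` — all remaining hypotheses are
geometric and jointly satisfiable. [folklore] -/
example (B : Unit × Unit → ℂ) :
    (1 : ℝ) ^ 2 / (2 * (1 * 1) + 0 * 0) * nsq B ≤
      (star B ⬝ᵥ (sandwich (covLap 2 (fun _ : Unit => ()) (fun _ => ()) (fun _ => (1 : Matrix Unit Unit ℝ)))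
        (covFamily (fun (_ : Unit) (_ : Unit) => (1 : ℝ)) fun _ _ => (1 : Matrix Unit Unit ℝ)) *ᵥ B)).re := by
  have hhol : ∀ (b y : Unit) (v : Unit → ℂ), l2 (cpx (hol (fun _ : Unit => ()) (fun _ => ())
      (fun _ => (1 : Matrix Unit Unit ℝ)) (fun (_ : Unit) (_ : Unit) => (1 : Matrix Unit Unit ℝ)) b y - 1) *ᵥ v) ≤
      0 * l2 v := by
    intro b y v
    have : hol (fun _ : Unit => ()) (fun _ => ()) (fun _ => (1 : Matrix Unit Unit ℝ))
        (fun (_ : Unit) (_ : Unit) => (1 : Matrix Unit Unit ℝ)) b y = 1 := by simp [hol]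
    rw [this, sub_self, show cpx (0 : Matrix Unit Unit ℝ) = 0 from map_zero _, Matrix.zero_mulVec, l2_zero, zero_mul]
  exact coarse_coercive_covLap two_pos (fun _ : Unit => ()) (fun _ => ()) (fun _ => (1 : Matrix Unit Unit ℝ))
    (fun _ _ => (1 : ℝ)) (fun _ _ => (1 : ℝ)) (fun y y' _ hy => (hy (Subsingleton.elim y y')).elim)
    (fun _ _ => (1 : Matrix Unit Unit ℝ)) (fun _ _ => by simp) (fun _ => by simp) one_pos (fun _ => by simp)
    (fun _ _ => (0 : ℝ)) (fun _ _ => le_rfl) hhol zero_le_one (fun _ => by simp) (fun _ => by simp) le_rfl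
    (fun _ => by simp) (fun _ => by simp) (by norm_num) B

/-! ## §5 (v1.1) `covLap` IS `gramForm` of the covariant bond differences -/

omit [Fintype S] in
/-- `covLap μ src tgt W = CoarseCoerciveBlock1D.gramForm μ (covDiff src tgt W)` — definitionally (g39's `gramForm μ D =
μ·1 + DᴴD`; co-owner d4-p2's MODEL END `CovariantPlateauBlocksEnd.coarse_coercive_plateau_blocks` is stated on this
carrier). [folklore] -/
theorem covLap_eq_gramForm (μ0 : ℝ) (src tgt : ι → S) (W : ι → Matrix Cp Cp ℝ) :
    covLap μ0 src tgt W = CoarseCoerciveBlock1D.gramForm μ0 (covDiff src tgt W) := rfl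

/-! ## §6 (v1.1) Gram domination with a gradient weight `κ`, and the two-transport assembly -/

omit [DecidableEq S] in
/-- **ENERGY WITH A GRADIENT WEIGHT**: `Re z*Az ≤ μ‖z‖² + κ‖D_W z‖²` (`μ, κ ≥ 0`) ⟹ `Re ρ_B*Aρ_B ≤ (μS₁S₂ + κθ₁′θ₂′)‖B‖²` for
the covariant superposition `ρ_B = Σ B·covFamily t R` (the sibling's two counting lemmas, recombined). [folklore] -/
theorem energy_superpose_covFamily_le_kappa [DecidableEq S] (A : Matrix (S × Cp) (S × Cp) ℂ) (src tgt : ι → S)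
    (W : ι → Matrix Cp Cp ℝ) {μ0 κ : ℝ} (hμ : 0 ≤ μ0) (hκ : 0 ≤ κ)
    (hA : ∀ z : S × Cp → ℂ, (star z ⬝ᵥ (A *ᵥ z)).re ≤ μ0 * nsq z + κ * nsq (covDiff src tgt W *ᵥ z))
    (t : μ → S → ℝ) (R : μ → S → Matrix Cp Cp ℝ) (hR : ∀ y x, R y x * (R y x)ᵀ = 1)
    (hW : ∀ b, (W b)ᵀ * W b = 1) (h : ι → μ → ℝ) (hh : ∀ b y, 0 ≤ h b y)
    (hhol : ∀ b y v, l2 (cpx (hol src tgt W R b y - 1) *ᵥ v) ≤ h b y * l2 v) {S₁ S₂ θ₁ θ₂ : ℝ} (hS0 : 0 ≤ S₁)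
    (hS₁ : ∀ x, ∑ y, |t y x| ≤ S₁) (hS₂ : ∀ y, ∑ x, |t y x| ≤ S₂) (hθ0 : 0 ≤ θ₁)
    (hθ₁ : ∀ b, ∑ y, (|t y (tgt b) - t y (src b)| + |t y (src b)| * h b y) ≤ θ₁)
    (hθ₂ : ∀ y, ∑ b, (|t y (tgt b) - t y (src b)| + |t y (src b)| * h b y) ≤ θ₂) (B : μ × Cp → ℂ) :
    (star (superpose (covFamily t R) B) ⬝ᵥ (A *ᵥ superpose (covFamily t R) B)).re ≤
      (μ0 * (S₁ * S₂) + κ * (θ₁ * θ₂)) * nsq B := by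
  have h1 := mul_le_mul_of_nonneg_left (CoarseCoerciveCovariantEnergy.nsq_superpose_covFamily_le t R hR hS0 hS₁ hS₂ B) hμ
  have h2 := mul_le_mul_of_nonneg_left
    (CoarseCoerciveCovariantEnergy.nsq_covDiff_superpose_covFamily_le src tgt W t R hR hW h hh hhol hθ0 hθ₁ hθ₂ B) hκ
  have h3 := hA (superpose (covFamily t R) B)
  linarith

omit [DecidableEq S] in
/-- **TWO-TRANSPORT COARSE COERCIVITY WITH A GRADIENT WEIGHT**: co-owner d4-p3's `coarse_coercive_cov₂` (average on `R`,
bump on `R̃`, mixed-loop defect `ε`, thin-loop bound `h` on `R̃`) with the Gram domination `Re z*Az ≤ μ‖z‖² + κ‖D_W z‖²`: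
`((1−ε)δ)²∕(μS₁S₂ + κθ₁′θ₂′)·‖B‖² ≤ Re B*(sandwich A (covFamily s R))B` — `massCoercive_covFamily₂` ∘
`fibreMass_coercive_of_defect` (p222847) + `sandwich_coercive_of_quasiReconstruction` (p219759) BY NAME. [folklore] -/
theorem coarse_coercive_cov₂_kappa [DecidableEq S] [DecidableEq μ] (A : Matrix (S × Cp) (S × Cp) ℂ) (hH : A.IsHermitian) (hU : IsUnit A)
    (hpsd : ∀ g : S × Cp → ℂ, 0 ≤ (star g ⬝ᵥ (A *ᵥ g)).re) (src tgt : ι → S) (W : ι → Matrix Cp Cp ℝ)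
    {μ0 κ : ℝ} (hμ : 0 ≤ μ0) (hκ : 0 ≤ κ)
    (hA : ∀ z : S × Cp → ℂ, (star z ⬝ᵥ (A *ᵥ z)).re ≤ μ0 * nsq z + κ * nsq (covDiff src tgt W *ᵥ z))
    (t s : μ → S → ℝ) (hdisj : ∀ y y' x, y ≠ y' → t y x * s y' x = 0) (hts : ∀ y x, 0 ≤ t y x * s y x)
    (R Rt : μ → S → Matrix Cp Cp ℝ) (hRt : ∀ y x, Rt y x * (Rt y x)ᵀ = 1) (hW : ∀ b, (W b)ᵀ * W b = 1)
    {δ ε : ℝ} (hδ0 : 0 < δ) (hδ : ∀ y, δ ≤ ∑ x, t y x * s y x) (hε : ε < 1)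
    (hdef : ∀ y x (v : Cp → ℂ), l2 ((cpx (Rt y x * (R y x)ᵀ) - 1) *ᵥ v) ≤ ε * l2 v)
    (h : ι → μ → ℝ) (hh : ∀ b y, 0 ≤ h b y)
    (hhol : ∀ b y v, l2 (cpx (hol src tgt W Rt b y - 1) *ᵥ v) ≤ h b y * l2 v) {S₁ S₂ θ₁ θ₂ : ℝ} (hS0 : 0 ≤ S₁)
    (hS₁ : ∀ x, ∑ y, |t y x| ≤ S₁) (hS₂ : ∀ y, ∑ x, |t y x| ≤ S₂) (hθ0 : 0 ≤ θ₁)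
    (hθ₁ : ∀ b, ∑ y, (|t y (tgt b) - t y (src b)| + |t y (src b)| * h b y) ≤ θ₁)
    (hθ₂ : ∀ y, ∑ b, (|t y (tgt b) - t y (src b)| + |t y (src b)| * h b y) ≤ θ₂)
    (hE : 0 < μ0 * (S₁ * S₂) + κ * (θ₁ * θ₂)) (B : μ × Cp → ℂ) :
    ((1 - ε) * δ) ^ 2 / (μ0 * (S₁ * S₂) + κ * (θ₁ * θ₂)) * nsq B ≤
      (star B ⬝ᵥ (sandwich A (covFamily s R) *ᵥ B)).re :=
  CoarseCoerciveQuasiReconstruction.sandwich_coercive_of_quasiReconstruction A hH hU hpsd (covFamily s R) (covFamily t Rt)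
    (mul_pos (sub_pos.2 hε) hδ0) hE
    (CoarseCoerciveTransportPair.massCoercive_covFamily₂ t s hdisj Rt R
      (CoarseCoerciveTransportPair.fibreMass_coercive_of_defect t s hts hδ Rt R hε.le hdef))
    (energy_superpose_covFamily_le_kappa A src tgt W hμ hκ hA t Rt hRt hW h hh hhol hS0 hS₁ hS₂ hθ0 hθ₁ hθ₂) B

/-! ## §7 (v1.1) The two-transport ENDs for the (perturbed) covariant Laplacian -/

omit [DecidableEq S] in
/-- **THE PURE COVARIANT LAPLACIAN, TWO TRANSPORTS** (the j-uniform instance for print's composed averages, E-I3-1):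
`A = μ·1 + D_WᴴD_W`, `μ > 0`; average on `R`, bump on `R̃` (`R̃R̃ᵀ = 1`), mixed-loop defect `ε < 1`, thin-loop bound `h` on `R̃`
⟹ `((1−ε)δ)²∕(μS₁S₂ + θ₁′θ₂′)·‖B‖² ≤ Re B*(Q A⁻¹ Q*)B`. [cite: Balaban1985BackgroundPropagators, (3.16) p.393, (3.35) p.396] -/
theorem coarse_coercive_covLap₂ [DecidableEq S] [DecidableEq μ] {μ0 : ℝ} (hμ : 0 < μ0) (src tgt : ι → S) (W : ι → Matrix Cp Cp ℝ)
    (t s : μ → S → ℝ) (hdisj : ∀ y y' x, y ≠ y' → t y x * s y' x = 0) (hts : ∀ y x, 0 ≤ t y x * s y x)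
    (R Rt : μ → S → Matrix Cp Cp ℝ) (hRt : ∀ y x, Rt y x * (Rt y x)ᵀ = 1) (hW : ∀ b, (W b)ᵀ * W b = 1)
    {δ ε : ℝ} (hδ0 : 0 < δ) (hδ : ∀ y, δ ≤ ∑ x, t y x * s y x) (hε : ε < 1)
    (hdef : ∀ y x (v : Cp → ℂ), l2 ((cpx (Rt y x * (R y x)ᵀ) - 1) *ᵥ v) ≤ ε * l2 v)
    (h : ι → μ → ℝ) (hh : ∀ b y, 0 ≤ h b y)
    (hhol : ∀ b y v, l2 (cpx (hol src tgt W Rt b y - 1) *ᵥ v) ≤ h b y * l2 v) {S₁ S₂ θ₁ θ₂ : ℝ} (hS0 : 0 ≤ S₁)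
    (hS₁ : ∀ x, ∑ y, |t y x| ≤ S₁) (hS₂ : ∀ y, ∑ x, |t y x| ≤ S₂) (hθ0 : 0 ≤ θ₁)
    (hθ₁ : ∀ b, ∑ y, (|t y (tgt b) - t y (src b)| + |t y (src b)| * h b y) ≤ θ₁)
    (hθ₂ : ∀ y, ∑ b, (|t y (tgt b) - t y (src b)| + |t y (src b)| * h b y) ≤ θ₂)
    (hE : 0 < μ0 * (S₁ * S₂) + θ₁ * θ₂) (B : μ × Cp → ℂ) :
    ((1 - ε) * δ) ^ 2 / (μ0 * (S₁ * S₂) + θ₁ * θ₂) * nsq B ≤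
      (star B ⬝ᵥ (sandwich (covLap μ0 src tgt W) (covFamily s R) *ᵥ B)).re :=
  CoarseCoerciveTransportPair.coarse_coercive_cov₂ (covLap μ0 src tgt W) (covLap_isHermitian μ0 src tgt W)
    (covLap_isUnit hμ src tgt W) (covLap_re_nonneg hμ.le src tgt W) src tgt W hμ.le
    (fun z => (re_form_covLap μ0 src tgt W z).le) t s hdisj hts R Rt hRt hW hδ0 hδ hε hdef h hh hhol hS0 hS₁ hS₂ hθ0 hθ₁
    hθ₂ hE B

omit [DecidableEq S] in
/-- **PSD PERTURBATION, TWO TRANSPORTS, NO SIZE RESTRICTION**: `A = covLap μ W + P`, `P` Hermitian with `0 ≤ Re z*Pz ≤ p‖z‖²`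
(the positive a-terms `Σ_j a(L^jη)^{d−2}|Q_jz|²` of (3.16)), `p ≥ 0` of ANY size ⟹
`((1−ε)δ)²∕((μ + p)S₁S₂ + θ₁′θ₂′)·‖B‖² ≤ Re B*(Q A⁻¹ Q*)B`. [cite: Balaban1985BackgroundPropagators, (3.16) p.393] -/
theorem coarse_coercive_covLap₂_add_psd [DecidableEq S] [DecidableEq μ] {μ0 : ℝ} (hμ : 0 < μ0) (src tgt : ι → S)
    (W : ι → Matrix Cp Cp ℝ) {P : Matrix (S × Cp) (S × Cp) ℂ} (hP : P.IsHermitian) {p : ℝ} (hp0 : 0 ≤ p)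
    (hP0 : ∀ z : S × Cp → ℂ, 0 ≤ (star z ⬝ᵥ (P *ᵥ z)).re) (hPb : ∀ z : S × Cp → ℂ, (star z ⬝ᵥ (P *ᵥ z)).re ≤ p * nsq z)
    (t s : μ → S → ℝ) (hdisj : ∀ y y' x, y ≠ y' → t y x * s y' x = 0) (hts : ∀ y x, 0 ≤ t y x * s y x)
    (R Rt : μ → S → Matrix Cp Cp ℝ) (hRt : ∀ y x, Rt y x * (Rt y x)ᵀ = 1) (hW : ∀ b, (W b)ᵀ * W b = 1)
    {δ ε : ℝ} (hδ0 : 0 < δ) (hδ : ∀ y, δ ≤ ∑ x, t y x * s y x) (hε : ε < 1)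
    (hdef : ∀ y x (v : Cp → ℂ), l2 ((cpx (Rt y x * (R y x)ᵀ) - 1) *ᵥ v) ≤ ε * l2 v)
    (h : ι → μ → ℝ) (hh : ∀ b y, 0 ≤ h b y)
    (hhol : ∀ b y v, l2 (cpx (hol src tgt W Rt b y - 1) *ᵥ v) ≤ h b y * l2 v) {S₁ S₂ θ₁ θ₂ : ℝ} (hS0 : 0 ≤ S₁)
    (hS₁ : ∀ x, ∑ y, |t y x| ≤ S₁) (hS₂ : ∀ y, ∑ x, |t y x| ≤ S₂) (hθ0 : 0 ≤ θ₁)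
    (hθ₁ : ∀ b, ∑ y, (|t y (tgt b) - t y (src b)| + |t y (src b)| * h b y) ≤ θ₁)
    (hθ₂ : ∀ y, ∑ b, (|t y (tgt b) - t y (src b)| + |t y (src b)| * h b y) ≤ θ₂)
    (hE : 0 < (μ0 + p) * (S₁ * S₂) + θ₁ * θ₂) (B : μ × Cp → ℂ) :
    ((1 - ε) * δ) ^ 2 / ((μ0 + p) * (S₁ * S₂) + θ₁ * θ₂) * nsq B ≤
      (star B ⬝ᵥ (sandwich (covLap μ0 src tgt W + P) (covFamily s R) *ᵥ B)).re := by
  have hco : ∀ z : S × Cp → ℂ, μ0 * nsq z ≤ (star z ⬝ᵥ ((covLap μ0 src tgt W + P) *ᵥ z)).re := fun z => by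
    rw [Matrix.add_mulVec, dotProduct_add, Complex.add_re]
    exact (covLap_reCoercive μ0 src tgt W z).trans (le_add_of_nonneg_right (hP0 z))
  have hA : ∀ z : S × Cp → ℂ, (star z ⬝ᵥ ((covLap μ0 src tgt W + P) *ᵥ z)).re ≤
      (μ0 + p) * nsq z + nsq (covDiff src tgt W *ᵥ z) := fun z => by
    rw [Matrix.add_mulVec, dotProduct_add, Complex.add_re, re_form_covLap]
    have := hPb z
    linarith
  exact CoarseCoerciveTransportPair.coarse_coercive_cov₂ (covLap μ0 src tgt W + P) (covLap_add_isHermitian μ0 src tgt W hP)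
    (isUnit_of_reCoercive hμ hco) (fun g => (mul_nonneg hμ.le (nsq_nonneg g)).trans (hco g)) src tgt W
    (add_nonneg hμ.le hp0) hA t s hdisj hts R Rt hRt hW hδ0 hδ hε hdef h hh hhol hS0 hS₁ hS₂ hθ0 hθ₁ hθ₂ hE B

omit [DecidableEq S] in
/-- **RELATIVE PERTURBATION, TWO TRANSPORTS**: `A = covLap μ W + P`, `P` Hermitian with `|Re z*Pz| ≤ ρ·Re z*(covLap μ W)z`,
`ρ < 1` (Δ″ small RELATIVE to the covariant Laplacian — co-owner d4-p3's socket remark, XREAD C-d4p3-17 INFO-2) ⟹ `A` is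
`Re`-coercive with `(1−ρ)μ`, Gram-dominated with `((1+ρ)μ, κ = 1+ρ)`, and
`((1−ε)δ)²∕((1+ρ)μS₁S₂ + (1+ρ)θ₁′θ₂′)·‖B‖² ≤ Re B*(Q A⁻¹ Q*)B`. [cite: Balaban1985BackgroundPropagators, (3.16) p.393] -/
theorem coarse_coercive_covLap₂_add_rel [DecidableEq S] [DecidableEq μ] {μ0 : ℝ} (hμ : 0 < μ0) (src tgt : ι → S)
    (W : ι → Matrix Cp Cp ℝ) {P : Matrix (S × Cp) (S × Cp) ℂ} (hP : P.IsHermitian) {ρ : ℝ} (hρ0 : 0 ≤ ρ) (hρ1 : ρ < 1)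
    (hPb : ∀ z : S × Cp → ℂ, |(star z ⬝ᵥ (P *ᵥ z)).re| ≤ ρ * (star z ⬝ᵥ (covLap μ0 src tgt W *ᵥ z)).re)
    (t s : μ → S → ℝ) (hdisj : ∀ y y' x, y ≠ y' → t y x * s y' x = 0) (hts : ∀ y x, 0 ≤ t y x * s y x)
    (R Rt : μ → S → Matrix Cp Cp ℝ) (hRt : ∀ y x, Rt y x * (Rt y x)ᵀ = 1) (hW : ∀ b, (W b)ᵀ * W b = 1)
    {δ ε : ℝ} (hδ0 : 0 < δ) (hδ : ∀ y, δ ≤ ∑ x, t y x * s y x) (hε : ε < 1)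
    (hdef : ∀ y x (v : Cp → ℂ), l2 ((cpx (Rt y x * (R y x)ᵀ) - 1) *ᵥ v) ≤ ε * l2 v)
    (h : ι → μ → ℝ) (hh : ∀ b y, 0 ≤ h b y)
    (hhol : ∀ b y v, l2 (cpx (hol src tgt W Rt b y - 1) *ᵥ v) ≤ h b y * l2 v) {S₁ S₂ θ₁ θ₂ : ℝ} (hS0 : 0 ≤ S₁)
    (hS₁ : ∀ x, ∑ y, |t y x| ≤ S₁) (hS₂ : ∀ y, ∑ x, |t y x| ≤ S₂) (hθ0 : 0 ≤ θ₁)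
    (hθ₁ : ∀ b, ∑ y, (|t y (tgt b) - t y (src b)| + |t y (src b)| * h b y) ≤ θ₁)
    (hθ₂ : ∀ y, ∑ b, (|t y (tgt b) - t y (src b)| + |t y (src b)| * h b y) ≤ θ₂)
    (hE : 0 < (1 + ρ) * μ0 * (S₁ * S₂) + (1 + ρ) * (θ₁ * θ₂)) (B : μ × Cp → ℂ) :
    ((1 - ε) * δ) ^ 2 / ((1 + ρ) * μ0 * (S₁ * S₂) + (1 + ρ) * (θ₁ * θ₂)) * nsq B ≤
      (star B ⬝ᵥ (sandwich (covLap μ0 src tgt W + P) (covFamily s R) *ᵥ B)).re := by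
  have hco : ∀ z : S × Cp → ℂ, (1 - ρ) * μ0 * nsq z ≤ (star z ⬝ᵥ ((covLap μ0 src tgt W + P) *ᵥ z)).re := fun z => by
    rw [Matrix.add_mulVec, dotProduct_add, Complex.add_re]
    have h1 := covLap_reCoercive μ0 src tgt W z
    have h2 := (abs_le.1 (hPb z)).1
    have h3 : 0 ≤ (star z ⬝ᵥ (covLap μ0 src tgt W *ᵥ z)).re := covLap_re_nonneg hμ.le src tgt W z
    nlinarith [nsq_nonneg z]
  have hA : ∀ z : S × Cp → ℂ, (star z ⬝ᵥ ((covLap μ0 src tgt W + P) *ᵥ z)).re ≤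
      (1 + ρ) * μ0 * nsq z + (1 + ρ) * nsq (covDiff src tgt W *ᵥ z) := fun z => by
    rw [Matrix.add_mulVec, dotProduct_add, Complex.add_re]
    have h2 := (abs_le.1 (hPb z)).2
    rw [re_form_covLap] at h2 ⊢
    nlinarith [nsq_nonneg z, nsq_nonneg (covDiff src tgt W *ᵥ z)]
  have hγ : 0 < (1 - ρ) * μ0 := mul_pos (sub_pos.2 hρ1) hμ
  exact coarse_coercive_cov₂_kappa (covLap μ0 src tgt W + P) (covLap_add_isHermitian μ0 src tgt W hP)
    (isUnit_of_reCoercive hγ hco) (fun g => (mul_nonneg hγ.le (nsq_nonneg g)).trans (hco g)) src tgt W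
    (by positivity) (by positivity) hA t s hdisj hts R Rt hRt hW hδ0 hδ hε hdef h hh hhol hS0 hS₁ hS₂ hθ0 hθ₁ hθ₂ hE B

end

end Summit.QuantumFields.BalabanUV.Beta.CoarseCoerciveCovariantLaplacian
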